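import Summits.QuantumFields.QCD.Theses.QuarksAsStableAction
import Literature.MathematicalPhysics.QuantumLattice.WilsonDiracAP
import Summits.QuantumFields.QCD.Theorems.QuarksAsStableActionCriticalLineDiamagnetismStubFreeDetFormula

/-!
# Partial plane waves for the static frequency factorisation (auxiliary file)
(helper for crux stmt-QuantumFields-9734, line `Sketch`, stub `stub_frequencyFactorisation`)

Toolkit for the factorisation `det D_W[lift A] = ∏_{k₀,k₁} det fD(A, m, π(2k₀+1)/L, π(2k₁+1)/L)` of the
Wilson determinant of a statically lifted 2D field (`…StubFrequencyFactorisation.lean`).  On `(ℤ/L)⁴`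
(colour `Fin 3`, spin `Fin 4`) let `V` be the `U(3)` field with the CONSTANT central phase `ω = e^{iπ/L}·1`
on the `0,1`-links and the seam-signed 2D field `±A(x₂,x₃,j)` on the `j = 2,3`-links, and let
`χ_k(x) = e(k₀x₀) e(k₁x₁)`, `e = ZMod.stdAddChar`, `k ∈ (Fin L)²`, be the plane waves in the directions `0,1`.
* Phases: `e^{iπ/L} e(k) = cos φ + i sin φ`, `φ = π(2k+1)/L` (`phase_mul_stdAddChar`, and its conjugate).
* Orthogonality: `Σ_a conj e(k'a) e(ka) = L δ_{kk'}` for `k, k' < L` (`sum_conj_stdAddChar_mul`), hence on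
  every slice `{(x₂,x₃) = t}`: `Σ conj χ_{k'} χ_k = L² δ_{kk'}` (`sum_slice_char`).
* The partial plane-wave matrix `P((x,a,α),((s,k))) = [((x₂,x₃),a,α) = s] χ_k(x)`: right action of block
  diagonal matrices (`P_mul_blockDiagonal_apply`), left action of single-site-supported rows
  (`rowHop_mul_P_apply`), and `Pᴴ P = L² • 1` (`P_conjTranspose_mul_self`).
* Seam ↔ phase in the static directions (`gaugeTransform_eq_lift`): gauging `V` by
  `x ↦ ω^{val x₀ + val x₁}` gives the static lift of `A` (antiperiodic `±1` pattern on the `0,1`-links since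
  `ω^L = -1`; the `2,3`-links are unchanged, the gauge function being central and constant along them).
References: Montvay–Münster, *Quantum Fields on a Lattice* §4.2.4 (antiperiodic Wilson fermions = constant
`U(1)` twist, momentum space), §5.1.1 (gauge transformations); folklore.  Pure theorem file (no `def`s):
`ω, V, χ, P` are variables with defining hypotheses `hω, hV, hχ, hP`, instantiated by `rfl`.
-/

noncomputable section

open scoped BigOperators Matrix ComplexConjugate
open Finset
open Literature.MathematicalPhysics.QuantumLattice Literature.MathematicalPhysics.QuantumFieldTheory
  Literature.Probability.LatticeModels

namespace Summit.QuantumFields.QCD.Cruxes.CriticalLineDiamagnetism.ChessboardCellGain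
namespace FrequencyFactorisation

open Complex (I)
open Literature.MathematicalPhysics (QuantumFieldTheory.Site.shift)

variable {L : ℕ} [NeZero L]

/-! ### Twisted phases and one-dimensional orthogonality -/

/-- `e(k) = exp(2πik/L)` for a natural number `k` (`e = ZMod.stdAddChar`). -/
theorem stdAddChar_natCast (k : ℕ) :
    (ZMod.stdAddChar ((k : ℕ) : ZMod L) : ℂ) = Complex.exp (2 * Real.pi * I * (k : ℂ) / (L : ℂ)) := by
  rw [← Int.cast_natCast, ZMod.stdAddChar_coe, Int.cast_natCast]

/-- The twisted plane-wave phase of a forward hop: `e^{iπ/L} e(k) = cos φ + i sin φ`, `φ = π(2k+1)/L`. -/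
theorem phase_mul_stdAddChar (k : ℕ) :
    Complex.exp (↑(Real.pi / L) * I) * (ZMod.stdAddChar ((k : ℕ) : ZMod L) : ℂ) =
      ((Real.cos (Real.pi * (2 * k + 1) / L) : ℝ) : ℂ) +
        ((Real.sin (Real.pi * (2 * k + 1) / L) : ℝ) : ℂ) * I := by
  rw [stdAddChar_natCast, ← Complex.exp_add, Complex.ofReal_cos, Complex.ofReal_sin,
    ← Complex.exp_mul_I]
  congr 1
  have hL : (L : ℂ) ≠ 0 := Nat.cast_ne_zero.2 (NeZero.ne L)
  push_cast
  field_simp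
  ring

/-- The twisted plane-wave phase of a backward hop: `e^{-iπ/L} conj e(k) = cos φ - i sin φ`. -/
theorem conj_phase_mul_stdAddChar (k : ℕ) :
    Complex.exp (-(↑(Real.pi / L) * I)) * conj (ZMod.stdAddChar ((k : ℕ) : ZMod L) : ℂ) =
      ((Real.cos (Real.pi * (2 * k + 1) / L) : ℝ) : ℂ) -
        ((Real.sin (Real.pi * (2 * k + 1) / L) : ℝ) : ℂ) * I := by
  have h := congrArg conj (phase_mul_stdAddChar (L := L) k)
  rw [map_mul, ← Complex.exp_conj, map_mul, Complex.conj_ofReal, Complex.conj_I, mul_neg] at h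
  rw [h, map_add, map_mul, Complex.conj_ofReal, Complex.conj_ofReal, Complex.conj_I]
  ring

/-- One-dimensional orthogonality: `Σ_a conj e(k'a) e(ka) = L δ_{kk'}` for `k, k' < L`. -/
theorem sum_conj_stdAddChar_mul (k k' : Fin L) :
    ∑ a : ZMod L, conj (ZMod.stdAddChar (((k' : ℕ) : ZMod L) * a) : ℂ) *
        (ZMod.stdAddChar (((k : ℕ) : ZMod L) * a) : ℂ) = if k = k' then (L : ℂ) else 0 := by
  have h : ∀ a : ZMod L, conj (ZMod.stdAddChar (((k' : ℕ) : ZMod L) * a) : ℂ) *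
      (ZMod.stdAddChar (((k : ℕ) : ZMod L) * a) : ℂ) =
      ZMod.stdAddChar (a * (((k : ℕ) : ZMod L) - ((k' : ℕ) : ZMod L))) := fun a => by
    rw [← AddChar.map_neg_eq_conj, ← AddChar.map_add_eq_mul]; congr 1; ring
  simp_rw [h]
  rw [AddChar.sum_mulShift _ (ZMod.isPrimitive_stdAddChar L), ZMod.card, Nat.cast_ite, Nat.cast_zero]
  by_cases hk : k = k'
  · rw [if_pos (by rw [hk, sub_self]), if_pos hk]
  · have hne : ((k : ℕ) : ZMod L) ≠ ((k' : ℕ) : ZMod L) := fun h' => hk (Fin.ext (by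
      have := congrArg ZMod.val h'
      rwa [ZMod.val_natCast_of_lt k.2, ZMod.val_natCast_of_lt k'.2] at this))
    rw [if_neg (fun h' => hne (sub_eq_zero.1 h')), if_neg hk]

/-! ### Partial plane waves in the directions `0, 1` -/

section PlaneWaves

variable (A : ZMod L → ZMod L → Fin 4 → Matrix.unitaryGroup (Fin 3) ℂ)
  (ω : Matrix.unitaryGroup (Fin 3) ℂ)
  (hω : (ω : Matrix (Fin 3) (Fin 3) ℂ) = Complex.exp (↑(Real.pi / L) * I) • (1 : Matrix (Fin 3) (Fin 3) ℂ))
  (V : GaugeConfig 4 L (Matrix.unitaryGroup (Fin 3) ℂ))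
  (hV : V = fun e => if e.2 = 0 ∨ e.2 = 1 then ω
    else (if e.1 e.2 = -1 then -(A (e.1 2) (e.1 3) e.2) else A (e.1 2) (e.1 3) e.2))
  (χ : Fin L × Fin L → TorusSite 4 L → ℂ)
  (hχ : χ = fun k x => (ZMod.stdAddChar (((k.1 : ℕ) : ZMod L) * x 0) : ℂ) *
    (ZMod.stdAddChar (((k.2 : ℕ) : ZMod L) * x 1) : ℂ))
  (P : Matrix (TorusSite 4 L × Fin 3 × Fin 4) (((ZMod L × ZMod L) × Fin 3 × Fin 4) × (Fin L × Fin L)) ℂ)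
  (hP : P = Matrix.of fun p q => if ((p.1 2, p.1 3), p.2) = q.1 then χ q.2 p.1 else 0)

include hχ in
/-- `χ_k(x + y) = χ_k(x) χ_k(y)`. -/
theorem char_add (k : Fin L × Fin L) (x y : TorusSite 4 L) : χ k (x + y) = χ k x * χ k y := by
  subst hχ; simp only [Pi.add_apply, mul_add, AddChar.map_add_eq_mul]; ring

include hχ in
/-- `χ_k(x - y) = χ_k(x) conj χ_k(y)`. -/
theorem char_sub (k : Fin L × Fin L) (x y : TorusSite 4 L) : χ k (x - y) = χ k x * conj (χ k y) := by
  rw [sub_eq_add_neg, char_add χ hχ]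
  subst hχ
  simp only [Pi.neg_apply, mul_neg, AddChar.map_neg_eq_conj, map_mul]

include hχ in
/-- `χ_k` at the unit vectors: `e(k₀)`, `e(k₁)`, `1`, `1`. -/
theorem char_single (k : Fin L × Fin L) (μ : Fin 4) : χ k (Pi.single μ 1) =
    if μ = 0 then (ZMod.stdAddChar ((k.1 : ℕ) : ZMod L) : ℂ)
    else if μ = 1 then (ZMod.stdAddChar ((k.2 : ℕ) : ZMod L) : ℂ) else 1 := by
  subst hχ
  fin_cases μ <;> simp

include hχ in
/-- **Orthogonality of the partial plane waves on a slice** `{x : (x₂,x₃) = t}` of `(ℤ/L)⁴`: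
`Σ conj χ_{k'}(x) χ_k(x) = L² δ_{kk'}`. -/
theorem sum_slice_char (t : ZMod L × ZMod L) (k k' : Fin L × Fin L) :
    ∑ x : TorusSite 4 L, (if (x 2, x 3) = t then conj (χ k' x) * χ k x else 0) =
      if k = k' then (L : ℂ) ^ 2 else 0 := by
  subst hχ
  let e : (ZMod L × ZMod L) × (ZMod L × ZMod L) ≃ TorusSite 4 L :=
    ⟨fun y => ![y.1.1, y.1.2, y.2.1, y.2.2], fun x => ((x 0, x 1), (x 2, x 3)),
      fun y => rfl, fun x => by funext i; fin_cases i <;> rfl⟩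
  have he : ∀ y, e y 0 = y.1.1 ∧ e y 1 = y.1.2 ∧ (e y 2, e y 3) = y.2 := fun y => ⟨rfl, rfl, rfl⟩
  have hsplit : ∀ y : ZMod L × ZMod L,
      conj ((ZMod.stdAddChar (((k'.1 : ℕ) : ZMod L) * y.1) : ℂ) *
          (ZMod.stdAddChar (((k'.2 : ℕ) : ZMod L) * y.2) : ℂ)) *
        ((ZMod.stdAddChar (((k.1 : ℕ) : ZMod L) * y.1) : ℂ) *
          (ZMod.stdAddChar (((k.2 : ℕ) : ZMod L) * y.2) : ℂ)) =
      (conj (ZMod.stdAddChar (((k'.1 : ℕ) : ZMod L) * y.1) : ℂ) *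
          (ZMod.stdAddChar (((k.1 : ℕ) : ZMod L) * y.1) : ℂ)) *
        (conj (ZMod.stdAddChar (((k'.2 : ℕ) : ZMod L) * y.2) : ℂ) *
          (ZMod.stdAddChar (((k.2 : ℕ) : ZMod L) * y.2) : ℂ)) := by
    intro y; rw [map_mul]; ring
  rw [← e.sum_comp, Fintype.sum_prod_type]
  simp only [(he _).1, (he _).2.1, (he _).2.2, Finset.sum_ite_eq', Finset.mem_univ, if_true, hsplit]
  rw [Fintype.sum_prod_type]
  simp_rw [← Finset.mul_sum, ← Finset.sum_mul, sum_conj_stdAddChar_mul]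
  obtain ⟨k₀, k₁⟩ := k
  obtain ⟨k₀', k₁'⟩ := k'
  by_cases h0 : k₀ = k₀' <;> by_cases h1 : k₁ = k₁' <;> simp [h0, h1, sq]

/-! ### The partial plane-wave matrix `P` -/

include hP in
/-- Right action of a block-diagonal matrix on the partial plane waves:
`(P · blockDiagonal F)((x,a,α), (s,k)) = χ_k(x) F_k(((x₂,x₃),a,α), s)`. -/
theorem P_mul_blockDiagonal_apply
    (F : Fin L × Fin L → Matrix ((ZMod L × ZMod L) × Fin 3 × Fin 4) ((ZMod L × ZMod L) × Fin 3 × Fin 4) ℂ)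
    (p : TorusSite 4 L × Fin 3 × Fin 4) (q : ((ZMod L × ZMod L) × Fin 3 × Fin 4) × (Fin L × Fin L)) :
    (P * Matrix.blockDiagonal F) p q = χ q.2 p.1 * F q.2 ((p.1 2, p.1 3), p.2) q.1 := by
  subst hP
  obtain ⟨s, k⟩ := q
  rw [Matrix.mul_apply, Fintype.sum_prod_type, Finset.sum_eq_single ((p.1 2, p.1 3), p.2)]
  · rw [Finset.sum_eq_single k]
    · rw [Matrix.of_apply, if_pos rfl, Matrix.blockDiagonal_apply_eq]
    · exact fun k' _ hk' => by rw [Matrix.blockDiagonal_apply_ne _ _ _ hk', mul_zero]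
    · exact fun h => absurd (Finset.mem_univ _) h
  · exact fun s' _ hs' => Finset.sum_eq_zero fun k' _ => by
      rw [Matrix.of_apply, if_neg (Ne.symm hs'), zero_mul]
  · exact fun h => absurd (Finset.mem_univ _) h

include hP in
/-- Left action on the partial plane waves of a matrix whose row `p` is supported on the single site
`y p`: `(M P)(p, ((t,c),k)) = [((y p)₂,(y p)₃) = t] g(p, c) χ_k(y p)`. -/
theorem rowHop_mul_P_apply (M : Matrix (TorusSite 4 L × Fin 3 × Fin 4) (TorusSite 4 L × Fin 3 × Fin 4) ℂ)
    (y : TorusSite 4 L × Fin 3 × Fin 4 → TorusSite 4 L)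
    (g : TorusSite 4 L × Fin 3 × Fin 4 → Fin 3 × Fin 4 → ℂ)
    (hM : ∀ p p', M p p' = if p'.1 = y p then g p p'.2 else 0) (p : TorusSite 4 L × Fin 3 × Fin 4)
    (q : ((ZMod L × ZMod L) × Fin 3 × Fin 4) × (Fin L × Fin L)) :
    (M * P) p q = if ((y p) 2, (y p) 3) = q.1.1 then g p q.1.2 * χ q.2 (y p) else 0 := by
  subst hP
  obtain ⟨⟨t, c⟩, k⟩ := q
  rw [Matrix.mul_apply, Fintype.sum_prod_type, Finset.sum_eq_single (y p)]
  · simp only [hM, Matrix.of_apply, if_true]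
    by_cases h : ((y p) 2, (y p) 3) = t
    · rw [if_pos h, Finset.sum_eq_single c]
      · rw [if_pos (show (((y p) 2, (y p) 3), c) = (t, c) by rw [h])]
      · exact fun c' _ hc => by rw [if_neg (fun h' => hc (Prod.mk.inj h').2), mul_zero]
      · exact fun h' => absurd (Finset.mem_univ _) h'
    · rw [if_neg h]
      exact Finset.sum_eq_zero fun c' _ => by rw [if_neg (fun h' => h (Prod.mk.inj h').1), mul_zero]
  · exact fun x' _ hx' => Finset.sum_eq_zero fun c' _ => by rw [hM, if_neg hx', zero_mul]
  · exact fun h => absurd (Finset.mem_univ _) h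

include hχ hP in
/-- **Orthogonality of the partial plane waves**: `Pᴴ P = L² • 1`. -/
theorem P_conjTranspose_mul_self : Pᴴ * P = ((L : ℂ) ^ 2) • 1 := by
  subst hP
  ext ⟨s', k'⟩ ⟨s, k⟩
  rw [Matrix.mul_apply, Matrix.smul_apply, Matrix.one_apply, Fintype.sum_prod_type, smul_eq_mul]
  simp only [Matrix.conjTranspose_apply, Matrix.of_apply]
  by_cases hs : s' = s
  · subst hs
    have key : ∀ (c : Prop) [Decidable c] (u v : ℂ),
        star (if c then u else 0) * (if c then v else 0) = if c then conj u * v else 0 := by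
      intros; split_ifs <;> simp
    have key2 : ∀ (x : TorusSite 4 L) (v : ℂ),
        ∑ c : Fin 3 × Fin 4, (if ((x 2, x 3), c) = s' then v else 0) =
          if (x 2, x 3) = s'.1 then v else 0 := by
      intro x v
      obtain ⟨t, c₀⟩ := s'
      simp only [Prod.mk.injEq]
      by_cases h : (x 2, x 3) = t
      · simp only [h, true_and, Finset.sum_ite_eq', Finset.mem_univ, if_true]
      · simp only [h, false_and, if_false, Finset.sum_const_zero]
    simp_rw [key, key2, sum_slice_char χ hχ]
    by_cases hk : k = k'
    · subst hk; simp
    · rw [if_neg hk, if_neg (fun h => hk (Prod.mk.inj h).2.symm), mul_zero]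
  · rw [if_neg (fun h => hs (Prod.mk.inj h).1), mul_zero]
    refine Finset.sum_eq_zero fun x _ => Finset.sum_eq_zero fun c _ => ?_
    by_cases h1 : ((x 2, x 3), c) = s'
    · rw [if_neg (fun h2 : ((x 2, x 3), c) = s => hs (h1.symm.trans h2)), mul_zero]
    · rw [if_neg h1, star_zero, zero_mul]

/-! ### The hops of `D_W[V]` on the partial plane waves -/

include hV in
omit [NeZero L] in
/-- The `0,1`-links of `V` are the constant phase `ω`. -/
theorem V_apply_phase (x : TorusSite 4 L) {μ : Fin 4} (hμ : μ = 0 ∨ μ = 1) : V (x, μ) = ω := by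
  subst hV; exact if_pos hμ

include hV in
omit [NeZero L] in
/-- The `2,3`-links of `V` are the seam-signed links of `A`. -/
theorem V_apply_field (x : TorusSite 4 L) {μ : Fin 4} (hμ : ¬(μ = 0 ∨ μ = 1)) :
    V (x, μ) = if x μ = -1 then -(A (x 2) (x 3) μ) else A (x 2) (x 3) μ := by
  subst hV; exact if_neg hμ

omit [NeZero L] in
/-- `↑(±u)_{ij} = (±1) u_{ij}` in `U(3)`. -/
theorem coe_seam_apply (c : Prop) [Decidable c] (u : Matrix.unitaryGroup (Fin 3) ℂ) (i j : Fin 3) :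
    ((if c then -u else u : Matrix.unitaryGroup (Fin 3) ℂ) : Matrix (Fin 3) (Fin 3) ℂ) i j =
      (if c then (-1 : ℂ) else 1) * (u : Matrix (Fin 3) (Fin 3) ℂ) i j := by
  split_ifs <;> simp [Unitary.coe_neg]

omit [NeZero L] in
/-- `(↑(±u))ᴴ_{ij} = (±1) (uᴴ)_{ij}` in `U(3)`. -/
theorem star_coe_seam_apply (c : Prop) [Decidable c] (u : Matrix.unitaryGroup (Fin 3) ℂ) (i j : Fin 3) :
    (star ((if c then -u else u : Matrix.unitaryGroup (Fin 3) ℂ) : Matrix (Fin 3) (Fin 3) ℂ)) i j =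
      (if c then (-1 : ℂ) else 1) * (star (u : Matrix (Fin 3) (Fin 3) ℂ)) i j := by
  split_ifs <;> simp [Unitary.coe_neg, star_neg]

/-! ### The gauge step: the static lift is `V` gauged by `x ↦ ω^{val x₀ + val x₁}` -/

include hω hV in
/-- **Seam ↔ phase in the static directions.**  Gauging `V` (constant phase `ω = e^{iπ/L}` on the
`0,1`-links, seam-signed `A` on the `2,3`-links) by `x ↦ ω^{val x₀ + val x₁}` gives the static lift of `A`:
the antiperiodic `±1` pattern on the `0,1`-links (`ω^L = -1` across the seam) and unchanged `2,3`-links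
(the gauge function is central and constant along them). -/
theorem gaugeTransform_eq_lift :
    gaugeTransform (fun x : TorusSite 4 L => ω ^ ((x 0).val + (x 1).val)) V =
      fun e : Edge 4 L => if e.2 = 0 ∨ e.2 = 1 then
        (if e.1 e.2 = -1 then (-1 : Matrix.unitaryGroup (Fin 3) ℂ) else 1)
        else (if e.1 e.2 = -1 then -(A (e.1 2) (e.1 3) e.2) else A (e.1 2) (e.1 3) e.2) := by
  subst hV
  have hL : 1 ≤ L := NeZero.one_le
  funext ⟨x, μ⟩
  simp only [gaugeTransform]
  by_cases hμ : μ = 0 ∨ μ = 1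
  · rw [if_pos hμ, if_pos hμ]
    rcases hμ with rfl | rfl
    · rw [FreeDetFormula.shift_apply_self, FreeDetFormula.shift_apply_of_ne x (by decide : (1 : Fin 4) ≠ 0)]
      by_cases h : x 0 = -1
      · rw [if_pos h, h, neg_add_cancel, ZMod.val_zero, zero_add, FreeDetFormula.zmod_val_neg_one,
          ← pow_succ, show L - 1 + (x 1).val + 1 = L + (x 1).val by omega, pow_add, mul_inv_cancel_right,
          FreeDetFormula.phase_pow hω]
      · rw [if_neg h, FreeDetFormula.zmod_val_add_one h, ← pow_succ,
          show (x 0).val + (x 1).val + 1 = (x 0).val + 1 + (x 1).val by ring, mul_inv_cancel]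
    · rw [FreeDetFormula.shift_apply_self, FreeDetFormula.shift_apply_of_ne x (by decide : (0 : Fin 4) ≠ 1)]
      by_cases h : x 1 = -1
      · rw [if_pos h, h, neg_add_cancel, ZMod.val_zero, add_zero, FreeDetFormula.zmod_val_neg_one,
          ← pow_succ, show (x 0).val + (L - 1) + 1 = L + (x 0).val by omega, pow_add, mul_inv_cancel_right,
          FreeDetFormula.phase_pow hω]
      · rw [if_neg h, FreeDetFormula.zmod_val_add_one h, ← pow_succ, ← add_assoc, mul_inv_cancel]
  · rw [if_neg hμ, if_neg hμ, FreeDetFormula.shift_apply_of_ne x (fun h => hμ (Or.inl h.symm)),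
      FreeDetFormula.shift_apply_of_ne x (fun h => hμ (Or.inr h.symm))]
    have hc : ∀ (n : ℕ) (W : Matrix.unitaryGroup (Fin 3) ℂ), ω ^ n * W * (ω ^ n)⁻¹ = W := fun n W => by
      have h' : ω ^ n * W = W * ω ^ n := Subtype.ext (by
        rw [Matrix.UnitaryGroup.mul_val, Matrix.UnitaryGroup.mul_val, SubmonoidClass.coe_pow, hω, smul_pow,
          one_pow, Matrix.smul_mul, Matrix.mul_smul, Matrix.one_mul, Matrix.mul_one])
      rw [h', mul_inv_cancel_right]
    exact hc _ _

end PlaneWaves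

end FrequencyFactorisation

/-- **Seam ↔ phase in the static directions** (closed form of `FrequencyFactorisation.gaugeTransform_eq_lift`,
the registered theorem of this auxiliary file): gauging the field `V` — constant central phase `ω = e^{iπ/L}·1`
on the `0,1`-links, seam-signed `A` on the `2,3`-links — by `x ↦ ω^{val x₀ + val x₁}` gives the static lift
of the 2D field `A`. -/
theorem frequencyFactorisation_gaugeStep : ∀ (L : ℕ) [NeZero L] (A : ZMod L → ZMod L → Fin 4 → Matrix.unitaryGroup (Fin 3) ℂ) (ω : Matrix.unitaryGroup (Fin 3) ℂ), (ω : Matrix (Fin 3) (Fin 3) ℂ) = Complex.exp (((Real.pi / L : ℝ) : ℂ) * Complex.I) • (1 : Matrix (Fin 3) (Fin 3) ℂ) → Literature.MathematicalPhysics.QuantumFieldTheory.gaugeTransform (fun x : Literature.MathematicalPhysics.QuantumFieldTheory.Site 4 L => ω ^ ((x 0).val + (x 1).val)) (fun e : Literature.MathematicalPhysics.QuantumFieldTheory.Edge 4 L => if e.2 = 0 ∨ e.2 = 1 then ω else (if e.1 e.2 = -1 then -(A (e.1 2) (e.1 3) e.2) else A (e.1 2) (e.1 3) e.2)) = fun e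 : Literature.MathematicalPhysics.QuantumFieldTheory.Edge 4 L => if e.2 = 0 ∨ e.2 = 1 then (if e.1 e.2 = -1 then (-1 : Matrix.unitaryGroup (Fin 3) ℂ) else 1) else (if e.1 e.2 = -1 then -(A (e.1 2) (e.1 3) e.2) else A (e.1 2) (e.1 3) e.2) := by
  intro L _ A ω hω
  exact FrequencyFactorisation.gaugeTransform_eq_lift A ω hω _ rfl

end Summit.QuantumFields.QCD.Cruxes.CriticalLineDiamagnetism.ChessboardCellGain

end
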